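import Mathlib
import HarnessLib
import Summits.HubbardSuperconductivity.HubbardSuperconductivity.Theorems.ComplexGFFStiffnessF4lPrimeShrink
import Literature.MathematicalPhysics.StatisticalMechanics.AbkmPackageShrunkSlots
import Literature.MathematicalPhysics.StatisticalMechanics.AbkmPackageF4Reduction

/-!
# Crux `HypACumulant` — the SHRUNK-BALL bundles `H1bcStatementShrink`, `F4lPrimeShrink` HOLD, and
# `F4StatementShrink` from its two `S_k` cores ([ABKM19] Theorem 6.8 / Lemma 12.6, holomorphic route)

Route `route-HubbardSuperconductivity-ComplexGFFStiffness`, crux stmt-HubbardSuperconductivity-19154, children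
re-typed on the shrunk state ball (`AbkmPackageShrunkSlots`, planner cstrat-19154 g1): this file discharges the
named bundles from the landed slot theorems.

* **`h1bcStatementShrink_holds : H1bcStatementShrink d`** — from `h1bcStatement_shrink` (S6c holomorphic route);
* **`f4lPrimeShrink_of_twoKernelSkBound : TwoKernelSkBound d → F4lPrimeShrink d`** — from
  `f4l'_shrink_of_twoKernelSkBound`;
* **`f4StatementShrink_of_cores : TwoKernelSkBound d → F4l2Shrink d → F4StatementShrink d`** — the nine slots of the
  shrunk package from the two `S_k` cores: (F4a, F4b, F4a2, F4Φ2) by `exists_f4first_unif P.shrink`, (F4b2, F4Φ22) by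
  `l2GaussianCore P.shrink`, (F4l) by `TwoKernelSkBound` AT `P.shrink`, (F4l2) by `F4l2Shrink`, (F4l') as above.

All proved, no `sorry`; `TwoKernelSkBound`, `F4l2Shrink` enter only as explicit hypotheses (the two `S_k` cores that need
the Banach-grade two-kernel machinery).  Honest scope: rung route (stiffness of a complex Gaussian gradient field via
the [ABKM19] RG); nothing about superconductivity in the Hubbard model.

## References
* S. Adams, S. Buchholz, R. Kotecký, S. Müller, arXiv:1910.13564, Theorem 6.8, Lemma 8.4, Lemma 12.6 (12.51)–(12.53)
  [AdamsBuchholzKoteckyMuller2019].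
-/

noncomputable section

-- `Summit.<Summit>.<Problem>`: single-conjunct summit, the duplicate component is mandated (D-0017).
set_option linter.dupNamespace false

namespace Summit.HubbardSuperconductivity.HubbardSuperconductivity.Theorems.ComplexGFF

open Literature.MathematicalPhysics.StatisticalMechanics.GradientRG

variable {d : ℕ}

/-- **`H1bcStatementShrink d` holds**: every package admits an `N`-free joint state second-difference size of `S_q`
on the shrunk state ball. -/
theorem h1bcStatementShrink_holds : H1bcStatementShrink d := fun P _ _ => h1bcStatement_shrink P

/-- **`TwoKernelSkBound d → F4lPrimeShrink d`**: the mixed `q`/state slot on the shrunk ball from the `N`-free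
two-kernel bound on the Theorem-6.8 ball. -/
theorem f4lPrimeShrink_of_twoKernelSkBound (hTK : TwoKernelSkBound d) : F4lPrimeShrink d :=
  fun P _ _ => f4l'_shrink_of_twoKernelSkBound hTK P

/-- **`F4StatementShrink d` from its two `S_k` cores** (`TwoKernelSkBound`, `F4l2Shrink`); the seven other slots are
theorems of the tree, instantiated at the shrunk package. -/
theorem f4StatementShrink_of_cores (hTK : TwoKernelSkBound d) (hl2 : F4l2Shrink d) : F4StatementShrink d := by
  intro P _ _
  obtain ⟨aT, bT, aTT, φT, haT, hbT, haTT, hφT, hfirst⟩ := exists_f4first_unif P.shrink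
  obtain ⟨lT, hlT, hl⟩ := hTK P.shrink
  obtain ⟨lTT, hlTT, hl2'⟩ := hl2 P
  obtain ⟨lT', hlT', hl'⟩ := f4l'_shrink_of_twoKernelSkBound hTK P
  obtain ⟨bTT, φTT, hbTT, hφTT, hcore⟩ := l2GaussianCore (d := d) P.shrink
  refine ⟨aT, bT, lT, aTT, bTT, lTT, lT', φT, φTT, haT, hbT, hlT, haTT, hbTT, hlTT, hlT', hφT, hφTT,
    fun N M _ Q => ?_⟩
  obtain ⟨ha, hb, ha2, hΦ2⟩ := hfirst N M Q
  obtain ⟨hb2, hΦ22⟩ := hcore N M Q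
  exact ⟨ha, hb, hl N M Q, ha2, hb2, hl2' N M Q, hl' N M Q, hΦ2, hΦ22⟩

/-- The `d = 4` instances in the shape of the re-typed route children (by-name closers, pending the route edit):
`H1bcStatementShrink 4`. -/
theorem h1bcStatementShrink_four : H1bcStatementShrink 4 := h1bcStatementShrink_holds

/-- `TwoKernelSkBound 4 → F4lPrimeShrink 4`. -/
theorem f4lPrimeShrink_four : TwoKernelSkBound 4 → F4lPrimeShrink 4 := f4lPrimeShrink_of_twoKernelSkBound

end Summit.HubbardSuperconductivity.HubbardSuperconductivity.Theorems.ComplexGFF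

end
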